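import Literature.NumberTheory.LFunctions.ConnesProlateGuessLimit
import Literature.NumberTheory.LFunctions.ProlateParity
import HarnessLib

/-!
# Connes' Fact 6.4 from the prolate → Hermite asymptotics of `h_{0,λ}` and `h_{4,λ}`

Second link of the in-tree reduction of Connes 2026, Fact 6.4 (= Connes–Consani–Moscovici 2025,
Lemma 7.3; tree: `prolateGuess_tendsto_riemannXi`).  The file `ConnesProlateGuessLimit.lean` reduced
Fact 6.4 to two asymptotic statements about the prolate guess
`h_λ = A·(h_{4,λ} − ρ_λ h_{0,λ})`, `A = √3/2^{11/4}`, `ρ_λ = ∫_{−λ}^{λ}h_{4,λ}/∫_{−λ}^{λ}h_{0,λ}`: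
(E) `λ·h_λ(λ) → 0` and (W) `∫_0^λ |h_λ′ − h′|(1+x)dx → 0`, where `h = (π²x⁴ − (3/2)πx²)e^{−πx²}`.
THIS file reduces (E) and (W) to statements about the INDIVIDUAL prolate functions `h_{n,λ}`
(`n = 0, 4`) and the Hermite functions they converge to,

  `h_0(x) = 2^{1/4}e^{−πx²}`,  `h_4(x) = 2^{−5/4}3^{−1/2}(16π²x⁴ − 24πx² + 3)e^{−πx²}`

(the `L²(ℝ)`-normalised eigenfunctions of `−d²/dx² + 4π²x²` with eigenvalues `2π`, `18π`, positive
at `0`), namely, for `n = 0` and `n = 4`, uniformly over the prolate functions `f = h_{n,λ}`: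

* (Sₙ) `λ · max_{[−λ,λ]} |h_{n,λ} − h_n| → 0`   (CCM25 Lemma 7.2(i) gives `O(λ^{-2})` for the max;
  Meixner–Schäfke 1954, §3.2 Satz 9), and
* (Wₙ) `∫_0^λ |h_{n,λ}′ − h_n′|(1+x)dx → 0`   (the same asymptotics at the level of first
  derivatives, weighted; implied by (Sₙ) and the prolate differential equation — that implication is
  NOT formalised here).

Content: the algebra `h = A(h_4 − ρh_0)` with `ρ = ∫h_4/∫h_0 = √3/2^{3/2}` (from `∫_0^∞ h = 0`,
`integral_ofReal_connesHermiteH_Ioi`), `h′ = A(h_4′ − ρh_0′)`, `h_λ′ = A(h_{4,λ}′ − ρ_λh_{0,λ}′)` on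
`(−λ,λ)`, the convergence `ρ_λ → ρ` from (S₀), (S₄) (evenness of prolate functions,
`IsProlateFunction.even`, and Gaussian tails), and the resulting estimates
`λ|h_λ(λ)| ≤ A(λ|h_{4,λ}(λ)| + |ρ_λ|λ|h_{0,λ}(λ)|)`,
`∫_0^λ|h_λ′ − h′|(1+x) ≤ A(∫_0^λ|h_{4,λ}′ − h_4′|(1+x) + |ρ_λ|∫_0^λ|h_{0,λ}′ − h_0′|(1+x) + |ρ_λ − ρ|∫_0^∞|h_0′|(1+x))`.
Main theorem: `prolateGuess_tendsto_riemannXi_of_hermiteLimit` — (S₀), (S₄), (W₀), (W₄) (as explicit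
hypotheses; no new named fact) imply `prolateGuess_tendsto_riemannXi`.  THIS IS NOT AN RH STATEMENT.
-/

noncomputable section

open Real Complex Set MeasureTheory Filter Topology intervalIntegral

namespace Literature.NumberTheory.LFunctions

/-! ### The constants `A`, `ρ` and the Hermite functions `h_0`, `h_4` -/

/-- `A = √3/2^{11/4}`, the outer constant of the prolate guess `h_λ = A(h_{4,λ} − ρ_λh_{0,λ})`
(`prolateGuessH`). [cite: Connes2026Letter, §6.4] -/
def prolateGuessA : ℝ := Real.sqrt 3 / (2 : ℝ) ^ ((11 : ℝ) / 4)

/-- `A > 0`. [folklore] -/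
theorem prolateGuessA_pos : 0 < prolateGuessA := by
  unfold prolateGuessA; positivity

/-- The Hermite function `h_0(x) = 2^{1/4}e^{−πx²}` (`‖h_0‖_{L²(ℝ)} = 1`, `h_0(0) > 0`,
`−h_0″ + 4π²x²h_0 = 2π·h_0`). [cite: ConnesConsaniMoscovici2025, Lemma 7.2] -/
def hermiteH0 (x : ℝ) : ℝ := (2 : ℝ) ^ ((1 : ℝ) / 4) * Real.exp (-π * x ^ 2)

/-- The Hermite function `h_4(x) = 2^{−5/4}3^{−1/2}(16π²x⁴ − 24πx² + 3)e^{−πx²}`, written with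
`2^{−5/4}3^{−1/2} = 1/(16A)` (`‖h_4‖_{L²(ℝ)} = 1`, `h_4(0) > 0`, `−h_4″ + 4π²x²h_4 = 18π·h_4`).
[cite: ConnesConsaniMoscovici2025, Lemma 7.2] -/
def hermiteH4 (x : ℝ) : ℝ :=
  (16 * π ^ 2 * x ^ 4 - 24 * π * x ^ 2 + 3) * Real.exp (-π * x ^ 2) / (16 * prolateGuessA)

/-- `h_0′(x) = −2πx·2^{1/4}e^{−πx²}`. [folklore] -/
def hermiteH0' (x : ℝ) : ℝ := -(2 * π * x) * ((2 : ℝ) ^ ((1 : ℝ) / 4) * Real.exp (-π * x ^ 2))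

/-- `h_4′(x) = (−32π³x⁵ + 112π²x³ − 54πx)e^{−πx²}/(16A)`. [folklore] -/
def hermiteH4' (x : ℝ) : ℝ :=
  (-32 * π ^ 3 * x ^ 5 + 112 * π ^ 2 * x ^ 3 - 54 * π * x) * Real.exp (-π * x ^ 2)
    / (16 * prolateGuessA)

/-- `ρ = ∫_ℝ h_4/∫_ℝ h_0 = √3/2^{3/2}`, written as `3/(16·2^{1/4}·A)`: the limit of the ratios
`ρ_λ = ∫h_{4,λ}/∫h_{0,λ}`; `h = A(h_4 − ρh_0)`. [cite: Connes2026Letter, §6.4] -/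
def hermiteRho : ℝ := 3 / (16 * (2 : ℝ) ^ ((1 : ℝ) / 4) * prolateGuessA)

/-- `h = A·(h_4 − ρ·h_0)` (Connes' Hermite combination `connesHermiteH`). [cite: Connes2026Letter, §6.4] -/
theorem prolateGuessA_mul_hermite_sub (x : ℝ) :
    prolateGuessA * (hermiteH4 x - hermiteRho * hermiteH0 x) = connesHermiteH x := by
  have hA : prolateGuessA ≠ 0 := prolateGuessA_pos.ne'
  have h2 : (2 : ℝ) ^ ((1 : ℝ) / 4) ≠ 0 := (Real.rpow_pos_of_pos two_pos _).ne'
  simp only [hermiteH4, hermiteH0, hermiteRho, connesHermiteH]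
  field_simp
  ring

/-- `h′ = A·(h_4′ − ρ·h_0′)`. [folklore] -/
theorem prolateGuessA_mul_hermite_sub' (x : ℝ) :
    prolateGuessA * (hermiteH4' x - hermiteRho * hermiteH0' x) = connesHermiteH' x := by
  have hA : prolateGuessA ≠ 0 := prolateGuessA_pos.ne'
  have h2 : (2 : ℝ) ^ ((1 : ℝ) / 4) ≠ 0 := (Real.rpow_pos_of_pos two_pos _).ne'
  simp only [hermiteH4', hermiteH0', hermiteRho, connesHermiteH']
  field_simp
  ring

/-- `h_0′ = hermiteH0'`. [folklore] -/
theorem hasDerivAt_hermiteH0 (x : ℝ) : HasDerivAt hermiteH0 (hermiteH0' x) x := by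
  have a := (((hasDerivAt_pow 2 x).const_mul (-π)).exp).const_mul ((2 : ℝ) ^ ((1 : ℝ) / 4))
  have hfun : hermiteH0 = fun y : ℝ ↦ (2 : ℝ) ^ ((1 : ℝ) / 4) * Real.exp (-π * y ^ 2) := rfl
  rw [hfun]
  refine a.congr_deriv ?_
  simp only [hermiteH0']
  push_cast
  ring

/-- `h_4′ = hermiteH4'`. [folklore] -/
theorem hasDerivAt_hermiteH4 (x : ℝ) : HasDerivAt hermiteH4 (hermiteH4' x) x := by
  have a := (((((hasDerivAt_pow 4 x).const_mul (16 * π ^ 2)).fun_sub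
    ((hasDerivAt_pow 2 x).const_mul (24 * π))).add_const 3).fun_mul
      (((hasDerivAt_pow 2 x).const_mul (-π)).exp)).div_const (16 * prolateGuessA)
  have hfun : hermiteH4 = fun y : ℝ ↦
      (16 * π ^ 2 * y ^ 4 - 24 * π * y ^ 2 + 3) * Real.exp (-π * y ^ 2) / (16 * prolateGuessA) := rfl
  rw [hfun]
  refine a.congr_deriv ?_
  simp only [hermiteH4']
  push_cast
  ring

/-- `h_0` is continuous. [folklore] -/
theorem continuous_hermiteH0 : Continuous hermiteH0 := by unfold hermiteH0; fun_prop

/-- `h_4` is continuous. [folklore] -/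
theorem continuous_hermiteH4 : Continuous hermiteH4 := by unfold hermiteH4; fun_prop

/-- `h_0′` is continuous. [folklore] -/
theorem continuous_hermiteH0' : Continuous hermiteH0' := by unfold hermiteH0'; fun_prop

/-- `h_4′` is continuous. [folklore] -/
theorem continuous_hermiteH4' : Continuous hermiteH4' := by unfold hermiteH4'; fun_prop

/-- `h_0 > 0`. [folklore] -/
theorem hermiteH0_pos (x : ℝ) : 0 < hermiteH0 x := by unfold hermiteH0; positivity

/-- `h_0` is even. [folklore] -/
theorem hermiteH0_even (x : ℝ) : hermiteH0 (-x) = hermiteH0 x := by simp [hermiteH0]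

/-- `h_4` is even. [folklore] -/
theorem hermiteH4_even (x : ℝ) : hermiteH4 (-x) = hermiteH4 x := by
  have h4 : (-x) ^ 4 = x ^ 4 := by ring
  have h2 : (-x) ^ 2 = x ^ 2 := by ring
  simp only [hermiteH4, h4, h2]

/-- `x ↦ x^k e^{−πx²}` is integrable on `ℝ`. [folklore] -/
theorem integrable_pow_mul_exp_neg_pi_mul_sq (k : ℕ) :
    Integrable fun x : ℝ ↦ x ^ k * Real.exp (-π * x ^ 2) := by
  have h := integrable_rpow_mul_exp_neg_mul_sq Real.pi_pos (s := k)
    (by have := Nat.cast_nonneg (α := ℝ) k; linarith)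
  refine h.congr (ae_of_all _ fun x ↦ ?_)
  simp only [Real.rpow_natCast]

/-- `h_0` is integrable on `ℝ`. [folklore] -/
theorem integrable_hermiteH0 : Integrable hermiteH0 := by
  unfold hermiteH0
  exact (integrable_exp_neg_mul_sq Real.pi_pos).const_mul _

/-- `h_4` is integrable on `ℝ`. [folklore] -/
theorem integrable_hermiteH4 : Integrable hermiteH4 := by
  have h : Integrable fun x : ℝ ↦ ((16 * π ^ 2) * (x ^ 4 * Real.exp (-π * x ^ 2))
      - (24 * π) * (x ^ 2 * Real.exp (-π * x ^ 2)) + 3 * (x ^ 0 * Real.exp (-π * x ^ 2)))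
        / (16 * prolateGuessA) :=
    ((((integrable_pow_mul_exp_neg_pi_mul_sq 4).const_mul _).sub
      ((integrable_pow_mul_exp_neg_pi_mul_sq 2).const_mul _)).add
      ((integrable_pow_mul_exp_neg_pi_mul_sq 0).const_mul _)).div_const _
  refine h.congr (ae_of_all _ fun x ↦ ?_)
  simp only [hermiteH4]
  ring

/-- `|h_0′(x)|(1+x)` is integrable on `(0, ∞)`. [folklore] -/
theorem integrableOn_abs_hermiteH0'_mul : IntegrableOn (fun x ↦ |hermiteH0' x| * (1 + x)) (Ioi 0) := by
  have h : Integrable fun x : ℝ ↦ (2 * π * (2 : ℝ) ^ ((1 : ℝ) / 4)) *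
      (x ^ 1 * Real.exp (-π * x ^ 2) + x ^ 2 * Real.exp (-π * x ^ 2)) :=
    ((integrable_pow_mul_exp_neg_pi_mul_sq 1).add (integrable_pow_mul_exp_neg_pi_mul_sq 2)).const_mul _
  refine h.integrableOn.congr_fun (fun x hx ↦ ?_) measurableSet_Ioi
  have hx0 : 0 ≤ x := le_of_lt hx
  have h2 : 0 ≤ (2 : ℝ) ^ ((1 : ℝ) / 4) := (Real.rpow_pos_of_pos two_pos _).le
  simp only [hermiteH0']
  rw [show -(2 * π * x) * ((2 : ℝ) ^ ((1 : ℝ) / 4) * Real.exp (-π * x ^ 2))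
      = -(2 * π * (2 : ℝ) ^ ((1 : ℝ) / 4) * (x * Real.exp (-π * x ^ 2))) by ring,
    abs_neg, abs_of_nonneg (by positivity)]
  ring

/-- `x·h_0(x) → 0` as `x → ∞` (Gaussian decay). [folklore] -/
theorem tendsto_mul_hermiteH0_atTop : Tendsto (fun x : ℝ ↦ x * hermiteH0 x) atTop (𝓝 0) := by
  have hexp : Tendsto (fun x : ℝ ↦ Real.exp (-(1 / 2) * x)) atTop (𝓝 0) :=
    Real.tendsto_exp_comp_nhds_zero.mpr (tendsto_id.const_mul_atTop_of_neg (by norm_num))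
  have h1 : Tendsto (fun x : ℝ ↦ x ^ (1 : ℝ) * Real.exp (-π * x ^ 2)) atTop (𝓝 0) :=
    (rpow_mul_exp_neg_mul_sq_isLittleO_exp_neg Real.pi_pos _).trans_tendsto hexp
  have h := h1.const_mul ((2 : ℝ) ^ ((1 : ℝ) / 4))
  simp only [mul_zero] at h
  refine h.congr' ?_
  filter_upwards [eventually_gt_atTop (0 : ℝ)] with x hx
  simp only [hermiteH0, Real.rpow_one]
  ring

/-- `x·h_4(x) → 0` as `x → ∞` (Gaussian decay). [folklore] -/
theorem tendsto_mul_hermiteH4_atTop : Tendsto (fun x : ℝ ↦ x * hermiteH4 x) atTop (𝓝 0) := by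
  have hexp : Tendsto (fun x : ℝ ↦ Real.exp (-(1 / 2) * x)) atTop (𝓝 0) :=
    Real.tendsto_exp_comp_nhds_zero.mpr (tendsto_id.const_mul_atTop_of_neg (by norm_num))
  have h5 : Tendsto (fun x : ℝ ↦ x ^ (5 : ℝ) * Real.exp (-π * x ^ 2)) atTop (𝓝 0) :=
    (rpow_mul_exp_neg_mul_sq_isLittleO_exp_neg Real.pi_pos _).trans_tendsto hexp
  have h3 : Tendsto (fun x : ℝ ↦ x ^ (3 : ℝ) * Real.exp (-π * x ^ 2)) atTop (𝓝 0) :=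
    (rpow_mul_exp_neg_mul_sq_isLittleO_exp_neg Real.pi_pos _).trans_tendsto hexp
  have h1 : Tendsto (fun x : ℝ ↦ x ^ (1 : ℝ) * Real.exp (-π * x ^ 2)) atTop (𝓝 0) :=
    (rpow_mul_exp_neg_mul_sq_isLittleO_exp_neg Real.pi_pos _).trans_tendsto hexp
  have h := (((h5.const_mul (16 * π ^ 2)).sub (h3.const_mul (24 * π))).add
    (h1.const_mul 3)).div_const (16 * prolateGuessA)
  simp only [mul_zero, sub_zero, add_zero, zero_div] at h
  refine h.congr' ?_
  filter_upwards [eventually_gt_atTop (0 : ℝ)] with x hx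
  simp only [hermiteH4]
  rw [show (5 : ℝ) = ((5 : ℕ) : ℝ) by norm_num, show (3 : ℝ) = ((3 : ℕ) : ℝ) by norm_num,
    Real.rpow_natCast, Real.rpow_natCast, Real.rpow_one]
  ring

/-- `∫_0^∞ h_0 > 0`. [folklore] -/
theorem integral_hermiteH0_Ioi_pos : 0 < ∫ x in Ioi (0 : ℝ), hermiteH0 x := by
  have h : ∫ x in Ioi (0 : ℝ), hermiteH0 x = (2 : ℝ) ^ ((1 : ℝ) / 4) * (√(π / π) / 2) := by
    simp only [hermiteH0]
    rw [MeasureTheory.integral_const_mul, integral_gaussian_Ioi]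
  rw [h, div_self Real.pi_pos.ne', Real.sqrt_one]
  positivity

/-- `∫_0^∞ h_4 = ρ·∫_0^∞ h_0` (from `∫_0^∞ h = 0`, `integral_ofReal_connesHermiteH_Ioi`).
[cite: Connes2026Letter, §6.4] -/
theorem integral_hermiteH4_Ioi :
    ∫ x in Ioi (0 : ℝ), hermiteH4 x = hermiteRho * ∫ x in Ioi (0 : ℝ), hermiteH0 x := by
  have hh : ∫ x in Ioi (0 : ℝ), connesHermiteH x = 0 := by
    have h := integral_ofReal_connesHermiteH_Ioi
    rw [integral_complex_ofReal] at h
    exact_mod_cast h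
  have i4 : IntegrableOn hermiteH4 (Ioi 0) := integrable_hermiteH4.integrableOn
  have i0 : IntegrableOn hermiteH0 (Ioi 0) := integrable_hermiteH0.integrableOn
  have e : ∫ x in Ioi (0 : ℝ), connesHermiteH x
      = prolateGuessA * ((∫ x in Ioi (0 : ℝ), hermiteH4 x)
          - hermiteRho * ∫ x in Ioi (0 : ℝ), hermiteH0 x) := by
    rw [← MeasureTheory.integral_const_mul, ← MeasureTheory.integral_sub i4 (i0.const_mul _),
      ← MeasureTheory.integral_const_mul]
    refine setIntegral_congr_fun measurableSet_Ioi (fun x _ ↦ ?_)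
    rw [← prolateGuessA_mul_hermite_sub x]
  rw [e] at hh
  have hA : prolateGuessA ≠ 0 := prolateGuessA_pos.ne'
  have := (mul_eq_zero.1 hh).resolve_left hA
  linarith

/-! ### The prolate guess in terms of `A`, `ρ_λ`; its derivative -/

/-- The ratio `ρ_λ = ∫_{−λ}^{λ}h_{4,λ} / ∫_{−λ}^{λ}h_{0,λ}` in the prolate guess. [cite: Connes2026Letter, §6.4] -/
def prolateGuessRatio (lam : ℝ) (f0 f4 : ℝ → ℝ) : ℝ :=
  (∫ y in (-lam)..lam, f4 y) / (∫ y in (-lam)..lam, f0 y)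

/-- `h_λ(x) = A·(h_{4,λ}(x) − ρ_λ·h_{0,λ}(x))` (definitional). [cite: Connes2026Letter, §6.4] -/
theorem prolateGuessH_eq (lam : ℝ) (f0 f4 : ℝ → ℝ) (x : ℝ) :
    prolateGuessH lam f0 f4 x = prolateGuessA * (f4 x - prolateGuessRatio lam f0 f4 * f0 x) := rfl

/-- `h_λ′(x) = A·(h_{4,λ}′(x) − ρ_λ·h_{0,λ}′(x))` on `(−λ, λ)`. [cite: Connes2026Letter, §6.4] -/
theorem hasDerivAt_prolateGuessH {lam : ℝ} {f0 f4 : ℝ → ℝ} (h0 : IsProlateFunction lam 0 f0)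
    (h4 : IsProlateFunction lam 4 f4) {x : ℝ} (hx : x ∈ Ioo (-lam) lam) :
    HasDerivAt (prolateGuessH lam f0 f4)
      (prolateGuessA * (deriv f4 x - prolateGuessRatio lam f0 f4 * deriv f0 x)) x :=
  (((h4.differentiableAt hx).hasDerivAt).sub
    (((h0.differentiableAt hx).hasDerivAt).const_mul (prolateGuessRatio lam f0 f4))).const_mul
      prolateGuessA

/-- `deriv h_λ = A·(h_{4,λ}′ − ρ_λ·h_{0,λ}′)` on `(−λ, λ)`. [cite: Connes2026Letter, §6.4] -/
theorem deriv_prolateGuessH {lam : ℝ} {f0 f4 : ℝ → ℝ} (h0 : IsProlateFunction lam 0 f0)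
    (h4 : IsProlateFunction lam 4 f4) {x : ℝ} (hx : x ∈ Ioo (-lam) lam) :
    deriv (prolateGuessH lam f0 f4) x
      = prolateGuessA * (deriv f4 x - prolateGuessRatio lam f0 f4 * deriv f0 x) :=
  (hasDerivAt_prolateGuessH h0 h4 hx).deriv

/-- `h_{n,λ}′` is interval-integrable on `[0, λ]` (it is bounded on `(−λ,λ)`). [folklore] -/
theorem IsProlateFunction.intervalIntegrable_deriv {lam : ℝ} {n : ℕ} {f : ℝ → ℝ}
    (hf : IsProlateFunction lam n f) : IntervalIntegrable (deriv f) volume 0 lam := by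
  obtain ⟨B, hB⟩ := hf.exists_bound_deriv
  have hlam := hf.lam_pos
  rw [intervalIntegrable_iff_integrableOn_Ioo_of_le hlam.le]
  refine Measure.integrableOn_of_bounded (M := B) measure_Ioo_lt_top.ne
    (measurable_deriv f).aestronglyMeasurable (ae_restrict_of_forall_mem measurableSet_Ioo ?_)
  intro x hx
  rw [Real.norm_eq_abs]
  exact (hB x ⟨by linarith [hx.1], hx.2⟩).2

/-- `h_{n,λ}` is interval-integrable on `[−λ, λ]`. [folklore] -/
theorem IsProlateFunction.intervalIntegrable {lam : ℝ} {n : ℕ} {f : ℝ → ℝ}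
    (hf : IsProlateFunction lam n f) : IntervalIntegrable f volume (-lam) lam :=
  (hf.contDiffOn.continuousOn.mono (by rw [uIcc_of_le (by linarith [hf.lam_pos])])).intervalIntegrable

/-- If `λ·|f − g| ≤ δ` on `[−λ, λ]` for a prolate (hence even) `f`, then
`|∫_{−λ}^{λ} f − 2∫_0^λ g| ≤ 2δ`. [folklore] -/
theorem abs_integral_sub_two_mul_integral_le {lam : ℝ} {n : ℕ} {f : ℝ → ℝ} {g : ℝ → ℝ}
    (hf : IsProlateFunction lam n f) (hg : Continuous g) {δ : ℝ}
    (hδ : ∀ x ∈ Icc (-lam) lam, lam * |f x - g x| ≤ δ) :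
    |(∫ x in (-lam)..lam, f x) - 2 * ∫ x in (0 : ℝ)..lam, g x| ≤ 2 * δ := by
  have hlam := hf.lam_pos
  have hfi := hf.intervalIntegrable
  have hfi0 : IntervalIntegrable f volume 0 lam :=
    hfi.mono_set (by rw [uIcc_of_le hlam.le, uIcc_of_le (by linarith)]
                     exact Icc_subset_Icc (by linarith) le_rfl)
  have hgi : IntervalIntegrable g volume 0 lam := hg.intervalIntegrable _ _
  rw [integral_neg_self_eq_two_mul_of_even hlam.le hf.even hfi, ← mul_sub, abs_mul,
    abs_of_pos two_pos, ← intervalIntegral.integral_sub hfi0 hgi]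
  have hb : ‖∫ x in (0 : ℝ)..lam, (f x - g x)‖ ≤ δ / lam * |lam - 0| := by
    refine intervalIntegral.norm_integral_le_of_norm_le_const (fun x hx ↦ ?_)
    rw [uIoc_of_le hlam.le] at hx
    rw [Real.norm_eq_abs, le_div_iff₀ hlam, mul_comm]
    exact hδ x ⟨by linarith [hx.1], hx.2⟩
  rw [sub_zero, abs_of_pos hlam, div_mul_cancel₀ _ hlam.ne'] at hb
  rw [Real.norm_eq_abs] at hb
  linarith

/-- **`ρ_λ → ρ`**: under the sup-norm asymptotics (S₀), (S₄) the ratio `ρ_λ = ∫h_{4,λ}/∫h_{0,λ}` tends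
to `ρ = ∫h_4/∫h_0`, uniformly over the prolate functions. [cite: ConnesConsaniMoscovici2025, Lemma 7.2] -/
theorem prolateGuessRatio_tendsto
    (hS0 : ∀ ε : ℝ, 0 < ε → ∃ Λ : ℝ, ∀ lam : ℝ, Λ ≤ lam → ∀ f : ℝ → ℝ,
      IsProlateFunction lam 0 f → ∀ x ∈ Icc (-lam) lam, lam * |f x - hermiteH0 x| ≤ ε)
    (hS4 : ∀ ε : ℝ, 0 < ε → ∃ Λ : ℝ, ∀ lam : ℝ, Λ ≤ lam → ∀ f : ℝ → ℝ,
      IsProlateFunction lam 4 f → ∀ x ∈ Icc (-lam) lam, lam * |f x - hermiteH4 x| ≤ ε)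
    (η : ℝ) (hη : 0 < η) :
    ∃ Λ : ℝ, ∀ lam : ℝ, Λ ≤ lam → ∀ f0 f4 : ℝ → ℝ, IsProlateFunction lam 0 f0 →
      IsProlateFunction lam 4 f4 → |prolateGuessRatio lam f0 f4 - hermiteRho| ≤ η := by
  set J0 := ∫ x in Ioi (0 : ℝ), hermiteH0 x with hJ0def
  have hJ0 : 0 < J0 := integral_hermiteH0_Ioi_pos
  have hJ4 : ∫ x in Ioi (0 : ℝ), hermiteH4 x = hermiteRho * J0 := integral_hermiteH4_Ioi
  set ρ := hermiteRho with hρdef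
  have hρ1 : 0 < 1 + |ρ| := by positivity
  -- the small parameter
  set e : ℝ := min (J0 / 4) (η * J0 / (4 * (1 + |ρ|))) with he_def
  have he : 0 < e := lt_min (by positivity) (by positivity)
  have he1 : e ≤ J0 / 4 := min_le_left _ _
  have he2 : e ≤ η * J0 / (4 * (1 + |ρ|)) := min_le_right _ _
  -- eventualities
  have T0 : ∀ᶠ lam : ℝ in atTop, |(∫ x in (0 : ℝ)..lam, hermiteH0 x) - J0| < e := by
    have h := intervalIntegral_tendsto_integral_Ioi 0 integrable_hermiteH0.integrableOn tendsto_id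
    have := Metric.tendsto_nhds.1 h e he
    simpa only [Real.dist_eq, id] using this
  have T4 : ∀ᶠ lam : ℝ in atTop, |(∫ x in (0 : ℝ)..lam, hermiteH4 x) - ρ * J0| < e := by
    have h := intervalIntegral_tendsto_integral_Ioi 0 integrable_hermiteH4.integrableOn tendsto_id
    rw [hJ4] at h
    have := Metric.tendsto_nhds.1 h e he
    simpa only [Real.dist_eq, id] using this
  obtain ⟨Λ0, hΛ0⟩ := hS0 e he
  obtain ⟨Λ4, hΛ4⟩ := hS4 e he
  obtain ⟨Λ, hΛ⟩ := eventually_atTop.1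
    (T0.and (T4.and ((eventually_atTop.2 ⟨Λ0, hΛ0⟩).and (eventually_atTop.2 ⟨Λ4, hΛ4⟩))))
  refine ⟨Λ, fun lam hlam f0 f4 h0 h4 ↦ ?_⟩
  obtain ⟨t0, t4, s0, s4⟩ := hΛ lam hlam
  have a0 := abs_integral_sub_two_mul_integral_le h0 continuous_hermiteH0 (s0 f0 h0)
  have a4 := abs_integral_sub_two_mul_integral_le h4 continuous_hermiteH4 (s4 f4 h4)
  unfold prolateGuessRatio
  set I0 := ∫ x in (-lam)..lam, f0 x with hI0
  set I4 := ∫ x in (-lam)..lam, f4 x with hI4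
  set T0' := ∫ x in (0 : ℝ)..lam, hermiteH0 x with hT0'
  set T4' := ∫ x in (0 : ℝ)..lam, hermiteH4 x with hT4'
  have b0 : |I0 - 2 * J0| ≤ 4 * e := by
    calc |I0 - 2 * J0| = |(I0 - 2 * T0') + 2 * (T0' - J0)| := by ring_nf
      _ ≤ |I0 - 2 * T0'| + |2 * (T0' - J0)| := abs_add_le _ _
      _ ≤ 2 * e + 2 * e := by rw [abs_mul, abs_two]; linarith [t0.le]
      _ = 4 * e := by ring
  have b4 : |I4 - 2 * (ρ * J0)| ≤ 4 * e := by
    calc |I4 - 2 * (ρ * J0)| = |(I4 - 2 * T4') + 2 * (T4' - ρ * J0)| := by ring_nf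
      _ ≤ |I4 - 2 * T4'| + |2 * (T4' - ρ * J0)| := abs_add_le _ _
      _ ≤ 2 * e + 2 * e := by rw [abs_mul, abs_two]; linarith [t4.le]
      _ = 4 * e := by ring
  have hI0pos : J0 ≤ I0 := by
    have := (abs_sub_le_iff.1 b0).2
    linarith
  have hI0ne : I0 ≠ 0 := by linarith
  have hnum : |I4 - ρ * I0| ≤ η * J0 := by
    have h4e : 4 * e * (1 + |ρ|) ≤ η * J0 := by
      have := (le_div_iff₀ (by positivity : (0 : ℝ) < 4 * (1 + |ρ|))).1 he2
      linarith
    calc |I4 - ρ * I0| = |(I4 - 2 * (ρ * J0)) - ρ * (I0 - 2 * J0)| := by ring_nf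
      _ ≤ |I4 - 2 * (ρ * J0)| + |ρ * (I0 - 2 * J0)| := abs_sub _ _
      _ ≤ 4 * e + |ρ| * (4 * e) := by
          rw [abs_mul]
          exact add_le_add b4 (mul_le_mul_of_nonneg_left b0 (abs_nonneg _))
      _ = 4 * e * (1 + |ρ|) := by ring
      _ ≤ η * J0 := h4e
  have hq : I4 / I0 - ρ = (I4 - ρ * I0) / I0 := by
    rw [eq_div_iff hI0ne, sub_mul, div_mul_cancel₀ _ hI0ne]
  rw [hq, abs_div, div_le_iff₀ (abs_pos.2 hI0ne), abs_of_pos (by linarith : (0 : ℝ) < I0)]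
  exact hnum.trans (mul_le_mul_of_nonneg_left hI0pos hη.le)

/-- **Connes' Fact 6.4 (= CCM25 Lemma 7.3) from the prolate → Hermite asymptotics of `h_{0,λ}` and
`h_{4,λ}`.**  Hypotheses (explicit; NOT proved in the tree — they are the uniform asymptotics of the
prolate spheroidal wave functions, Meixner–Schäfke 1954 §3.2 Satz 9, CCM25 Lemma 7.2(i), at the level
of the functions (`hS0`, `hS4`: `λ·max_{[−λ,λ]}|h_{n,λ} − h_n| → 0`) and of their first derivatives
(`hW0`, `hW4`: `∫_0^λ|h_{n,λ}′ − h_n′|(1+x)dx → 0`), `n = 0, 4`).  Conclusion: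
`prolateGuess_tendsto_riemannXi` (`4M_λ(s) → ξ(½+s)` uniformly on `|Re s| ≤ α₀ < ½`).  Proof:
`λ|h_λ(λ)| ≤ A(λ|h_{4,λ}(λ)| + |ρ_λ|λ|h_{0,λ}(λ)|)` and
`∫_0^λ|h_λ′ − h′|(1+x) ≤ A(∫_0^λ|h_{4,λ}′ − h_4′|(1+x) + |ρ_λ|∫_0^λ|h_{0,λ}′ − h_0′|(1+x) + |ρ_λ − ρ|·∫_0^∞|h_0′|(1+x))`
with `ρ_λ → ρ` (`prolateGuessRatio_tendsto`) and the Gaussian decay `λh_n(λ) → 0`, fed into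
`prolateGuess_tendsto_riemannXi_of_deriv_tendsto`.  No RH anywhere.
[cite: ConnesConsaniMoscovici2025, Lemma 7.2, Lemma 7.3; Connes2026Letter, §6.4 Fact 6.4] -/
theorem prolateGuess_tendsto_riemannXi_of_hermiteLimit
    (hS0 : ∀ ε : ℝ, 0 < ε → ∃ Λ : ℝ, ∀ lam : ℝ, Λ ≤ lam → ∀ f : ℝ → ℝ,
      IsProlateFunction lam 0 f → ∀ x ∈ Icc (-lam) lam, lam * |f x - hermiteH0 x| ≤ ε)
    (hS4 : ∀ ε : ℝ, 0 < ε → ∃ Λ : ℝ, ∀ lam : ℝ, Λ ≤ lam → ∀ f : ℝ → ℝ,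
      IsProlateFunction lam 4 f → ∀ x ∈ Icc (-lam) lam, lam * |f x - hermiteH4 x| ≤ ε)
    (hW0 : ∀ ε : ℝ, 0 < ε → ∃ Λ : ℝ, ∀ lam : ℝ, Λ ≤ lam → ∀ f : ℝ → ℝ,
      IsProlateFunction lam 0 f →
        (∫ x in (0 : ℝ)..lam, |deriv f x - hermiteH0' x| * (1 + x)) ≤ ε)
    (hW4 : ∀ ε : ℝ, 0 < ε → ∃ Λ : ℝ, ∀ lam : ℝ, Λ ≤ lam → ∀ f : ℝ → ℝ,
      IsProlateFunction lam 4 f →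
        (∫ x in (0 : ℝ)..lam, |deriv f x - hermiteH4' x| * (1 + x)) ≤ ε) :
    prolateGuess_tendsto_riemannXi := by
  have hA := prolateGuessA_pos
  set A := prolateGuessA with hAdef
  set ρ := hermiteRho with hρdef
  have hρ1 : 1 ≤ |ρ| + 1 := by linarith [abs_nonneg ρ]
  have hR := prolateGuessRatio_tendsto hS0 hS4
  -- eventual bound `|ρ_λ| ≤ |ρ| + 1`
  have Eρ : ∀ᶠ lam : ℝ in atTop, ∀ f0 f4 : ℝ → ℝ, IsProlateFunction lam 0 f0 →
      IsProlateFunction lam 4 f4 → |prolateGuessRatio lam f0 f4| ≤ |ρ| + 1 := by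
    obtain ⟨Λ, hΛ⟩ := hR 1 one_pos
    refine eventually_atTop.2 ⟨Λ, fun lam hlam f0 f4 h0 h4 ↦ ?_⟩
    have h := hΛ lam hlam f0 f4 h0 h4
    calc |prolateGuessRatio lam f0 f4| = |(prolateGuessRatio lam f0 f4 - ρ) + ρ| := by ring_nf
      _ ≤ |prolateGuessRatio lam f0 f4 - ρ| + |ρ| := abs_add_le _ _
      _ ≤ |ρ| + 1 := by linarith
  refine prolateGuess_tendsto_riemannXi_of_deriv_tendsto ?_ ?_
  · -- (E): endpoint decay
    intro ε hε
    set e : ℝ := ε / (4 * A * (|ρ| + 1)) with he_def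
    have he : 0 < e := by positivity
    have E4 : ∀ᶠ lam : ℝ in atTop, ∀ f : ℝ → ℝ, IsProlateFunction lam 4 f →
        ∀ x ∈ Icc (-lam) lam, lam * |f x - hermiteH4 x| ≤ e := by
      obtain ⟨Λ, hΛ⟩ := hS4 e he; exact eventually_atTop.2 ⟨Λ, hΛ⟩
    have E0 : ∀ᶠ lam : ℝ in atTop, ∀ f : ℝ → ℝ, IsProlateFunction lam 0 f →
        ∀ x ∈ Icc (-lam) lam, lam * |f x - hermiteH0 x| ≤ e := by
      obtain ⟨Λ, hΛ⟩ := hS0 e he; exact eventually_atTop.2 ⟨Λ, hΛ⟩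
    have G4 : ∀ᶠ lam : ℝ in atTop, |lam * hermiteH4 lam| < e := by
      have := Metric.tendsto_nhds.1 tendsto_mul_hermiteH4_atTop e he
      simpa only [Real.dist_eq, sub_zero] using this
    have G0 : ∀ᶠ lam : ℝ in atTop, |lam * hermiteH0 lam| < e := by
      have := Metric.tendsto_nhds.1 tendsto_mul_hermiteH0_atTop e he
      simpa only [Real.dist_eq, sub_zero] using this
    obtain ⟨Λ, hΛ⟩ := eventually_atTop.1
      ((eventually_gt_atTop 0).and (E4.and (E0.and (G4.and (G0.and Eρ)))))
    refine ⟨Λ, fun lam hlam f0 f4 h0 h4 ↦ ?_⟩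
    obtain ⟨hlam0, s4, s0, g4, g0, r⟩ := hΛ lam hlam
    have hmem : lam ∈ Icc (-lam) lam := ⟨by linarith, le_rfl⟩
    have u4 : lam * |f4 lam| ≤ 2 * e := by
      have h1 := s4 f4 h4 lam hmem
      have h2 : lam * |hermiteH4 lam| ≤ e := by
        have := g4.le
        rwa [abs_mul, abs_of_pos hlam0] at this
      have h3 : |f4 lam| ≤ |f4 lam - hermiteH4 lam| + |hermiteH4 lam| := by
        calc |f4 lam| = |(f4 lam - hermiteH4 lam) + hermiteH4 lam| := by ring_nf
          _ ≤ _ := abs_add_le _ _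
      nlinarith
    have u0 : lam * |f0 lam| ≤ 2 * e := by
      have h1 := s0 f0 h0 lam hmem
      have h2 : lam * |hermiteH0 lam| ≤ e := by
        have := g0.le
        rwa [abs_mul, abs_of_pos hlam0] at this
      have h3 : |f0 lam| ≤ |f0 lam - hermiteH0 lam| + |hermiteH0 lam| := by
        calc |f0 lam| = |(f0 lam - hermiteH0 lam) + hermiteH0 lam| := by ring_nf
          _ ≤ _ := abs_add_le _ _
      nlinarith
    have hr := r f0 f4 h0 h4
    rw [prolateGuessH_eq, abs_mul, abs_of_pos hA]
    have step : |f4 lam - prolateGuessRatio lam f0 f4 * f0 lam| * lam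
        ≤ 2 * e + (|ρ| + 1) * (2 * e) := by
      have h1 : |f4 lam - prolateGuessRatio lam f0 f4 * f0 lam|
          ≤ |f4 lam| + |prolateGuessRatio lam f0 f4| * |f0 lam| := by
        calc _ ≤ |f4 lam| + |prolateGuessRatio lam f0 f4 * f0 lam| := abs_sub _ _
          _ = _ := by rw [abs_mul]
      have h2 : |prolateGuessRatio lam f0 f4| * (lam * |f0 lam|) ≤ (|ρ| + 1) * (2 * e) :=
        mul_le_mul hr u0 (by positivity) (by positivity)
      nlinarith [abs_nonneg (f4 lam), abs_nonneg (f0 lam), abs_nonneg (prolateGuessRatio lam f0 f4)]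
    calc A * |f4 lam - prolateGuessRatio lam f0 f4 * f0 lam| * lam
        = A * (|f4 lam - prolateGuessRatio lam f0 f4 * f0 lam| * lam) := by ring
      _ ≤ A * (2 * e + (|ρ| + 1) * (2 * e)) := mul_le_mul_of_nonneg_left step hA.le
      _ ≤ A * ((|ρ| + 1) * (2 * e) + (|ρ| + 1) * (2 * e)) := by
          apply mul_le_mul_of_nonneg_left _ hA.le
          nlinarith
      _ = ε := by
          rw [he_def]; field_simp; ring
  · -- (W): weighted W¹¹ convergence
    intro ε hε
    set C1 := ∫ x in Ioi (0 : ℝ), |hermiteH0' x| * (1 + x) with hC1def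
    have hC1 : 0 ≤ C1 :=
      setIntegral_nonneg measurableSet_Ioi fun x hx ↦ mul_nonneg (abs_nonneg _) (by
        have : (0 : ℝ) < x := hx
        linarith)
    set e4 : ℝ := ε / (3 * A) with he4_def
    set e0 : ℝ := ε / (3 * A * (|ρ| + 1)) with he0_def
    set η : ℝ := ε / (3 * A * (C1 + 1)) with hη_def
    have he4 : 0 < e4 := by positivity
    have he0 : 0 < e0 := by positivity
    have hη : 0 < η := by positivity
    have E4 : ∀ᶠ lam : ℝ in atTop, ∀ f : ℝ → ℝ, IsProlateFunction lam 4 f →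
        (∫ x in (0 : ℝ)..lam, |deriv f x - hermiteH4' x| * (1 + x)) ≤ e4 := by
      obtain ⟨Λ, hΛ⟩ := hW4 e4 he4; exact eventually_atTop.2 ⟨Λ, hΛ⟩
    have E0 : ∀ᶠ lam : ℝ in atTop, ∀ f : ℝ → ℝ, IsProlateFunction lam 0 f →
        (∫ x in (0 : ℝ)..lam, |deriv f x - hermiteH0' x| * (1 + x)) ≤ e0 := by
      obtain ⟨Λ, hΛ⟩ := hW0 e0 he0; exact eventually_atTop.2 ⟨Λ, hΛ⟩
    have Eη : ∀ᶠ lam : ℝ in atTop, ∀ f0 f4 : ℝ → ℝ, IsProlateFunction lam 0 f0 →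
        IsProlateFunction lam 4 f4 → |prolateGuessRatio lam f0 f4 - ρ| ≤ η := by
      obtain ⟨Λ, hΛ⟩ := hR η hη; exact eventually_atTop.2 ⟨Λ, hΛ⟩
    obtain ⟨Λ, hΛ⟩ := eventually_atTop.1
      ((eventually_gt_atTop 0).and (E4.and (E0.and (Eη.and Eρ))))
    refine ⟨Λ, fun lam hlam f0 f4 h0 h4 ↦ ?_⟩
    obtain ⟨hlam0, w4, w0, rη, r⟩ := hΛ lam hlam
    have hw4 := w4 f4 h4
    have hw0 := w0 f0 h0
    have hr := r f0 f4 h0 h4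
    have hrη := rη f0 f4 h0 h4
    set R := prolateGuessRatio lam f0 f4 with hRdef
    -- integrability on `[0, λ]`
    obtain ⟨-, hdi⟩ := prolateGuessH_hasDerivAt h0 h4
    have iL : IntervalIntegrable
        (fun x ↦ |deriv (prolateGuessH lam f0 f4) x - connesHermiteH' x| * (1 + x)) volume 0 lam :=
      (hdi.sub (continuous_connesHermiteH'.intervalIntegrable _ _)).abs.mul_continuousOn
        (by fun_prop)
    have i4 : IntervalIntegrable (fun x ↦ |deriv f4 x - hermiteH4' x| * (1 + x)) volume 0 lam :=
      (h4.intervalIntegrable_deriv.sub (continuous_hermiteH4'.intervalIntegrable _ _)).abs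
        |>.mul_continuousOn (by fun_prop)
    have i0 : IntervalIntegrable (fun x ↦ |deriv f0 x - hermiteH0' x| * (1 + x)) volume 0 lam :=
      (h0.intervalIntegrable_deriv.sub (continuous_hermiteH0'.intervalIntegrable _ _)).abs
        |>.mul_continuousOn (by fun_prop)
    have ik : IntervalIntegrable (fun x ↦ |hermiteH0' x| * (1 + x)) volume 0 lam :=
      (continuous_hermiteH0'.abs.mul (continuous_const.add continuous_id)).intervalIntegrable _ _
    -- pointwise identity and bound on `(0, λ)`
    have hpt : ∀ x ∈ Ioo 0 lam,
        |deriv (prolateGuessH lam f0 f4) x - connesHermiteH' x| * (1 + x)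
          ≤ A * (|deriv f4 x - hermiteH4' x| * (1 + x) + |R| * (|deriv f0 x - hermiteH0' x| * (1 + x))
              + |R - ρ| * (|hermiteH0' x| * (1 + x))) := by
      intro x hx
      have hx' : x ∈ Ioo (-lam) lam := ⟨by linarith [hx.1], hx.2⟩
      have hx1 : 0 ≤ 1 + x := by linarith [hx.1]
      rw [deriv_prolateGuessH h0 h4 hx', ← prolateGuessA_mul_hermite_sub' x]
      have e : A * (deriv f4 x - R * deriv f0 x) - A * (hermiteH4' x - ρ * hermiteH0' x)
          = A * ((deriv f4 x - hermiteH4' x) - R * (deriv f0 x - hermiteH0' x)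
              - (R - ρ) * hermiteH0' x) := by ring
      rw [e, abs_mul, abs_of_pos hA, mul_assoc]
      refine mul_le_mul_of_nonneg_left ?_ hA.le
      have t : |(deriv f4 x - hermiteH4' x) - R * (deriv f0 x - hermiteH0' x) - (R - ρ) * hermiteH0' x|
          ≤ |deriv f4 x - hermiteH4' x| + |R| * |deriv f0 x - hermiteH0' x|
              + |R - ρ| * |hermiteH0' x| := by
        calc _ ≤ |(deriv f4 x - hermiteH4' x) - R * (deriv f0 x - hermiteH0' x)|
              + |(R - ρ) * hermiteH0' x| := abs_sub _ _
          _ ≤ |deriv f4 x - hermiteH4' x| + |R * (deriv f0 x - hermiteH0' x)|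
              + |(R - ρ) * hermiteH0' x| := by gcongr; exact abs_sub _ _
          _ = _ := by rw [abs_mul, abs_mul]
      have := mul_le_mul_of_nonneg_right t hx1
      linarith [this]
    have hint : (∫ x in (0 : ℝ)..lam,
        |deriv (prolateGuessH lam f0 f4) x - connesHermiteH' x| * (1 + x))
          ≤ ∫ x in (0 : ℝ)..lam, A * (|deriv f4 x - hermiteH4' x| * (1 + x)
              + |R| * (|deriv f0 x - hermiteH0' x| * (1 + x)) + |R - ρ| * (|hermiteH0' x| * (1 + x))) :=
      intervalIntegral.integral_mono_on_of_le_Ioo hlam0.le iL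
        (((i4.add (i0.const_mul |R|)).add (ik.const_mul |R - ρ|)).const_mul A) hpt
    have hsplit : (∫ x in (0 : ℝ)..lam, A * (|deriv f4 x - hermiteH4' x| * (1 + x)
        + |R| * (|deriv f0 x - hermiteH0' x| * (1 + x)) + |R - ρ| * (|hermiteH0' x| * (1 + x))))
          = A * ((∫ x in (0 : ℝ)..lam, |deriv f4 x - hermiteH4' x| * (1 + x))
              + |R| * (∫ x in (0 : ℝ)..lam, |deriv f0 x - hermiteH0' x| * (1 + x))
              + |R - ρ| * (∫ x in (0 : ℝ)..lam, |hermiteH0' x| * (1 + x))) := by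
      rw [intervalIntegral.integral_const_mul, intervalIntegral.integral_add (i4.add (i0.const_mul _))
        (ik.const_mul _), intervalIntegral.integral_add i4 (i0.const_mul _),
        intervalIntegral.integral_const_mul, intervalIntegral.integral_const_mul]
    have hk : (∫ x in (0 : ℝ)..lam, |hermiteH0' x| * (1 + x)) ≤ C1 := by
      rw [intervalIntegral.integral_of_le hlam0.le]
      exact setIntegral_mono_set integrableOn_abs_hermiteH0'_mul
        ((ae_restrict_mem measurableSet_Ioi).mono fun x hx ↦
          mul_nonneg (abs_nonneg _) (by have : (0 : ℝ) < x := hx; linarith))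
        Ioc_subset_Ioi_self.eventuallyLE
    have hk0 : 0 ≤ ∫ x in (0 : ℝ)..lam, |deriv f0 x - hermiteH0' x| * (1 + x) :=
      intervalIntegral.integral_nonneg hlam0.le fun x hx ↦
        mul_nonneg (abs_nonneg _) (by linarith [hx.1])
    -- the three pieces
    have p4 : A * (∫ x in (0 : ℝ)..lam, |deriv f4 x - hermiteH4' x| * (1 + x)) ≤ ε / 3 := by
      calc _ ≤ A * e4 := mul_le_mul_of_nonneg_left hw4 hA.le
        _ = ε / 3 := by rw [he4_def]; field_simp
    have p0 : A * (|R| * (∫ x in (0 : ℝ)..lam, |deriv f0 x - hermiteH0' x| * (1 + x))) ≤ ε / 3 := by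
      calc _ ≤ A * ((|ρ| + 1) * e0) :=
            mul_le_mul_of_nonneg_left (mul_le_mul hr hw0 hk0 (by positivity)) hA.le
        _ = ε / 3 := by rw [he0_def]; field_simp
    have pk : A * (|R - ρ| * (∫ x in (0 : ℝ)..lam, |hermiteH0' x| * (1 + x))) ≤ ε / 3 := by
      calc _ ≤ A * (η * C1) :=
            mul_le_mul_of_nonneg_left (mul_le_mul hrη hk
              (intervalIntegral.integral_nonneg hlam0.le fun x hx ↦
                mul_nonneg (abs_nonneg _) (by linarith [hx.1])) hη.le) hA.le
        _ ≤ A * (η * (C1 + 1)) := by gcongr; linarith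
        _ = ε / 3 := by rw [hη_def]; field_simp
    calc _ ≤ _ := hint
      _ = _ := hsplit
      _ = A * (∫ x in (0 : ℝ)..lam, |deriv f4 x - hermiteH4' x| * (1 + x))
          + A * (|R| * (∫ x in (0 : ℝ)..lam, |deriv f0 x - hermiteH0' x| * (1 + x)))
          + A * (|R - ρ| * (∫ x in (0 : ℝ)..lam, |hermiteH0' x| * (1 + x))) := by ring
      _ ≤ ε / 3 + ε / 3 + ε / 3 := add_le_add (add_le_add p4 p0) pk
      _ = ε := by ring

end Literature.NumberTheory.LFunctions
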